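import Summits.HodgeConjecture.HodgeConjecture.Theorems.Ring2WeilCoverageRealUnitNormReduction
import Mathlib.FieldTheory.Finite.GaloisField
import Mathlib.Algebra.GroupWithZero.Units.Fintype
import HarnessLib

/-!
# Weil-type family coverage — THEOREM L (i) AT THE CENSUS LEVELS `40` AND `52`: every unit of `ℚ(ζ₄₀)⁺` and of
# `ℚ(ζ₅₂)⁺` has norm `+1` (reduction modulo `5`, resp. `13`)

research route conditional on HC_CM; not a corollary; Q11.4-sentence-2 already refuted in dim ≥ 3.

Ring 2, WEIL-TYPE FAMILY-COVERAGE CENSUS (`HOME/WEIL-FAMILY-COVERAGE.md` `## b01`, blocks b01.28 THEOREM L (i), b01.42 (the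
norm-sign law, one-sided at `32/40/52`); owner ring2-b01), part 63 of the `Ring2WeilCoverage*` series: part 62's reduction
engine (`…RealUnitNormReduction.norm_realUnits_pos_of_reduction`) instantiated.

* **`norm_realUnits_pos_forty`** — `K = ℚ(ζ₄₀)`, `q = 5`, `R = 𝔽₂₅` (Mathlib `GaloisField 5 2`), `r` a primitive `8`-th
  root of unity in `R` (a cube of a generator of `Rˣ ≅ ℤ/24`), a root of `Φ₄₀ = Φ₈^4 (mod 5)`; `T` the half-system
  `{1, 3, 7, 9, 11, 13, 17, 19}`; congruences mod `8`: `t ≡ 1` or `−t ≡ 39t ≡ 1` (`e_t = 0`) for `t ≡ ±1`, `t ≡ 5` or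
  `39t ≡ 5` (`e_t = 1`) for `t ≡ ±3`; `E = 4·1 + 4·5 = 24 = |Rˣ|`.  So NO unit of `ℚ(ζ₄₀)⁺` has norm `−1`, although
  all three quadratic subfields `ℚ(√2), ℚ(√5), ℚ(√10)` (and `ℚ(√2, √5)`) have such units.
* **`norm_realUnits_pos_fiftyTwo`** — `K = ℚ(ζ₅₂)`, `q = 13`, `R = 𝔽₁₃` (`ZMod 13`), `r = 5` (`5² = −1`), a root of
  `Φ₅₂ = Φ₄^{12} (mod 13)`; `T` the half-system of the twelve unit residues `< 26`; all `t ≡ ±1 (mod 4)`, `e_t = 0`,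
  `E = 12 = |Rˣ|`.  So NO unit of `ℚ(ζ₅₂)⁺` has norm `−1`, although `ℚ(√13) ⊂ ℚ(ζ₅₂)⁺` has one.

With parts 8/9/10 (`21, 28, 36, 33, 44`), 31 (`35, 45`), 57 (`48, 60, 72, 84`) THEOREM L (i) is now a tree theorem at
EVERY census level except `32`, where it is false (part 61); part 64 makes the norm-sign law two-sided at `40` and `52`.

HONEST FRAMING: elementary (finite fields `𝔽₂₅`, `𝔽₁₃`; part 62); nothing here is a statement about Hodge classes,
`W_K`, general members or HC; `HC_CM` is used nowhere.  No `def`, no named fact, no `sorry`.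

References: [cite: Washington1997, §2, Prop. 2.16]; census b01.28 THEOREM L (i) (seat-derived proof).
-/

noncomputable section

open scoped Classical nonZeroDivisors NumberField
open NumberField Module Polynomial Finset

namespace Summit.HodgeConjecture.Ring2WeilCoverage.RealUnitNormLevels40and52

open Literature.AlgebraicGeometry.HodgeTheory (IsCMTypeSet)
open Summit.HodgeConjecture.Ring2WeilCoverage.RealUnitNormReduction (norm_realUnits_pos_of_reduction)

variable {K : Type} [Field K] [NumberField K] [IsCMField K] {ζ : K}

/-! ### Level `40`: reduction modulo `5`, `R = 𝔽₂₅` -/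

/-- **THEOREM L (i) AT `M = 40`: every unit `v` of `𝓞(ℚ(ζ₄₀)⁺)` has `N_{ℚ(ζ₄₀)⁺/ℚ}(v) > 0`** (reduction of `ℤ[ζ₄₀]`
modulo `5` onto `𝔽₂₅ = 𝔽₅(ζ₈)`: the automorphism product of a real unit over a half-system maps to `y^{24} = 1`, never to
`−1`; part 62).  The hypothesis `hN` of parts 2/7/55 at `n = 40`.
research route conditional on HC_CM; not a corollary; Q11.4-sentence-2 already refuted in dim ≥ 3. [cite: Washington1997, §2, Prop. 2.16] -/
theorem norm_realUnits_pos_forty [IsCyclotomicExtension {40} ℚ K] (hζ : IsPrimitiveRoot ζ 40)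
    (v : (𝓞 (maximalRealSubfield K))ˣ) :
    0 < Algebra.norm ℚ (((v : 𝓞 (maximalRealSubfield K)) : maximalRealSubfield K)) := by
  haveI : Fact (Nat.Prime 5) := ⟨by norm_num⟩
  -- `R = 𝔽₂₅`, `|R| = 25`, `|Rˣ| = 24`
  have hcard : Nat.card (GaloisField 5 2) = 25 := by rw [GaloisField.card 5 2 (by norm_num)]; norm_num
  have hunits : Nat.card (GaloisField 5 2)ˣ = 24 := by rw [Nat.card_units, hcard]
  -- a primitive `8`-th root of unity `r`: the cube of a generator of `Rˣ`
  obtain ⟨g, hg⟩ := IsCyclic.exists_ofOrder_eq_natCard (α := (GaloisField 5 2)ˣ)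
  rw [hunits] at hg
  have hg24 : IsPrimitiveRoot g 24 := by rw [← hg]; exact IsPrimitiveRoot.orderOf g
  have hr8 : IsPrimitiveRoot (((g ^ 3 : (GaloisField 5 2)ˣ)) : GaloisField 5 2) 8 :=
    IsPrimitiveRoot.coe_units_iff.mpr (hg24.pow (by norm_num) (by norm_num))
  haveI : NeZero ((8 : ℕ) : GaloisField 5 2) := ⟨by
    rw [Ne, CharP.cast_eq_zero_iff (GaloisField 5 2) 5 8]; norm_num⟩
  have hr : aeval (((g ^ 3 : (GaloisField 5 2)ˣ)) : GaloisField 5 2) (cyclotomic 40 ℤ) = 0 := by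
    rw [aeval_def, algebraMap_int_eq, ← eval_map, map_cyclotomic_int, show (40 : ℕ) = 5 ^ 1 * 8 by norm_num]
    exact (isRoot_cyclotomic_prime_pow_mul_iff_of_charP.mpr hr8).eq_zero
  have h2 : (2 : GaloisField 5 2) ≠ 0 := by
    rw [show (2 : GaloisField 5 2) = ((2 : ℕ) : GaloisField 5 2) by norm_cast, Ne,
      CharP.cast_eq_zero_iff (GaloisField 5 2) 5 2]
    norm_num
  -- the half-system and the exponents
  have hT : IsCMTypeSet 40 ({1, 3, 7, 9, 11, 13, 17, 19} : Finset (ZMod 40)) := by decide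
  refine norm_realUnits_pos_of_reduction hζ h2 hr hr8.pow_eq_one hT
    (fun t => if t.val % 8 = 1 ∨ t.val % 8 = 7 then 0 else 1) ?_ ?_ v
  · decide
  · intro y
    have hsum : (∑ t ∈ ({1, 3, 7, 9, 11, 13, 17, 19} : Finset (ZMod 40)),
        5 ^ ((fun t : ZMod 40 => if t.val % 8 = 1 ∨ t.val % 8 = 7 then 0 else 1) t)) = 24 := by
      decide
    have hy : y ^ 24 = 1 := by rw [← hunits]; exact pow_card_eq_one'
    rw [hsum, ← Units.val_pow_eq_pow_val, hy, Units.val_one]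

/-! ### Level `52`: reduction modulo `13`, `R = 𝔽₁₃` -/

/-- **THEOREM L (i) AT `M = 52`: every unit `v` of `𝓞(ℚ(ζ₅₂)⁺)` has `N_{ℚ(ζ₅₂)⁺/ℚ}(v) > 0`** (reduction of `ℤ[ζ₅₂]`
modulo `13` onto `𝔽₁₃`, `ζ₅₂ ↦ 5` of order `4`: the automorphism product of a real unit over a half-system maps to
`y^{12} = 1`, never to `−1`; part 62).  The hypothesis `hN` of parts 2/7/55 at `n = 52`.
research route conditional on HC_CM; not a corollary; Q11.4-sentence-2 already refuted in dim ≥ 3. [cite: Washington1997, §2, Prop. 2.16] -/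
theorem norm_realUnits_pos_fiftyTwo [IsCyclotomicExtension {52} ℚ K] (hζ : IsPrimitiveRoot ζ 52)
    (v : (𝓞 (maximalRealSubfield K))ˣ) :
    0 < Algebra.norm ℚ (((v : 𝓞 (maximalRealSubfield K)) : maximalRealSubfield K)) := by
  -- arithmetic in `ZMod 13` by `decide`, before the `Fact (Nat.Prime 13)` instance enters the context
  have h4 : IsPrimitiveRoot (5 : ZMod 13) 4 :=
    IsPrimitiveRoot.mk_of_lt 5 (by norm_num) (by decide) (fun l hl0 hl4 => by interval_cases l <;> decide)
  have hne4 : ((4 : ℕ) : ZMod 13) ≠ 0 := by decide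
  have h2 : (2 : ZMod 13) ≠ 0 := by decide
  have hn₀ : (5 : ZMod 13) ^ 4 = 1 := by decide
  haveI : Fact (Nat.Prime 13) := ⟨by norm_num⟩
  haveI : NeZero ((4 : ℕ) : ZMod 13) := ⟨hne4⟩
  have hr : aeval (5 : ZMod 13) (cyclotomic 52 ℤ) = 0 := by
    rw [aeval_def, algebraMap_int_eq, ← eval_map, map_cyclotomic_int, show (52 : ℕ) = 13 ^ 1 * 4 by norm_num]
    exact (isRoot_cyclotomic_prime_pow_mul_iff_of_charP.mpr h4).eq_zero
  have hT : IsCMTypeSet 52 ({1, 3, 5, 7, 9, 11, 15, 17, 19, 21, 23, 25} : Finset (ZMod 52)) := by decide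
  refine norm_realUnits_pos_of_reduction hζ h2 hr hn₀ hT (fun _ => 0) ?_ ?_ v
  · decide
  · intro y
    have hsum : (∑ t ∈ ({1, 3, 5, 7, 9, 11, 15, 17, 19, 21, 23, 25} : Finset (ZMod 52)),
        13 ^ ((fun _ : ZMod 52 => 0) t)) = 13 - 1 := by
      decide
    rw [hsum]
    exact ZMod.pow_card_sub_one_eq_one y.ne_zero

end Summit.HodgeConjecture.Ring2WeilCoverage.RealUnitNormLevels40and52

end
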